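import Summits.BirchSwinnertonDyer.BirchSwinnertonDyer.Theorems.KolyvaginRoadThreeSchneiderTamAtThreeHeightLogNumeratorSecondOrder
import Summits.BirchSwinnertonDyer.BirchSwinnertonDyer.Theorems.KolyvaginRoadThreeSchneiderTamAtThreeOddPrimeClosedForm
import Summits.BirchSwinnertonDyer.Rank1Residual.X11b.RegMultCertificateJoin
import Literature.NumberTheory.EllipticCurves.SteinWuthrich2013.MultiplicativeHeightExistenceProofs
import Literature.NumberTheory.EllipticCurves.PadicSigmaLogFirstOrderProofs
import HarnessLib

/-!
# Crux `SchneiderTamAtThree` (item 19154) — THE HEIGHT IS THE LOGARITHM OF THE NUMERATOR, SECOND ORDER,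
# part 3/3: `ĥ₃(P) ≡ log₃ num x + (b₂b₄/c₄)·den x/num x (mod 3^{2k+1})`, the SECOND-ORDER NUMERATOR
# CRITERION `3^{v₃(den x)+1} ∤ c₄(a³ − a) + 2b₂b₄·den x ⟹ ĥ₃(P) ≠ 0`, and Schneider's binder at `3`
# from one rational point (route-free)

HONEST FRAMING (cell `bsd-stepL`, seat `bsd-stepL-tam3-p2` g2, WIDTH-LEVER second lane «closed-form
Schneider local factor at 3 … finite case table proved once»; `--supports stmt-BirchSwinnertonDyer-19154
--as helper`): THEOREMS ONLY; 0 definitions, 0 named facts, 0 sorry; ROUTE-FREE (no Theses import — the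
crux-named corollary is the separate part 3b). Nothing here proves the crux class-wide, Schneider's
conjecture or BSD: the crux class-wide remains the transcendence-type statement `Σ²_E(P) ≠ den x(P)`.
What IS proved, class-wide and unconditionally, is the closed form of the height's first `2k + 1` digits
and the resulting decidable sufficient condition, one digit deeper than the first-order chain:

* `norm_heightFourOneCoord_sub_padicLog_num_sub_le` — **`‖ĥ₃(P) − log₃ num x − (b₂b₄/c₄)·den x/num x‖₃
  ≤ 3⁻¹‖x‖₃⁻¹`** (first order, part 4 of the first chain: `‖ĥ₃(P) − log₃ num x‖ ≤ ‖x‖⁻¹`).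
* `norm_heightFourOneCoord_mul_sub_le` — with `a = num x`, `D = den x`, `N = c₄a(a² − 1) + 2b₂b₄D`:
  `‖2ac₄·ĥ₃(P) − N‖₃ ≤ max(3⁻¹‖x‖⁻¹, ‖a² − 1‖²)` (Iwasawa: `log₃ a ≡ (a² − 1)/2`).
* `heightFourOneCoord_ne_zero_of_num_criterion₂` — **`3⁻¹‖x‖⁻¹ < ‖N‖ ⟹ ĥ₃(P) ≠ 0`**, i.e. in integers
  (`heightFourOneCoord_ne_zero_of_not_pow_succ_dvd`) **`3^{v₃(den x)+1} ∤ c₄(a³ − a) + 2b₂b₄·den x ⟹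
  ĥ₃(P) ≠ 0`**; this contains the first-order criterion (`3^{v₃ den x} ∤ a² − 1`) and decides, on lane
  A's table of record (kit j249075), 650 of the 690 TRUE-OPEN non-split (ram) X11b@3 rows with point data
  (first order: 543; the second-digit law holds in 147/147 first-order-silent rows, kit j281722).
* `regulatorNonvanishingAt_three_of_num_criterion₂` — for `W` minimal, non-split multiplicative at `3`,
  rank one: ONE admissible rational point passing the criterion gives `ClassClosure.RegulatorNonvanishingAt
  W 3` (Schneider's binder of the class record at `3`) — by integer arithmetic alone.

References: [SteinWuthrich2013] §4.1 (4.1), §4.2, Conj. 4.1; [Iwasawa1972PadicL] §4.4;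
[Schneider1982PadicHeightI] §1; tree: parts 1, 2a, 2b; part 4 of the first-order chain (same shapes,
first order); ui-o2 `Uniform/UI/O2SigmaValuation.lean`; `X11b/RegMultCertificateJoin.lean`.
-/

noncomputable section

open scoped Classical Nat
open Filter Topology IsUltrametricDist PowerSeries
open WeierstrassCurve Literature.NumberTheory.EllipticCurves
open Literature.NumberTheory.EllipticCurves.SteinWuthrich2013
open Literature.NumberTheory.EllipticCurves.TateCurve
open Literature.NumberTheory.EllipticCurves.Rank1Residual
open Summit.BirchSwinnertonDyer.Uniform.UI.O2

namespace Summit.BirchSwinnertonDyer.Rank1Residual.X11b.RegMult.HeightLogNumerator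

/-! ### §7 The height to second order and the second-order numerator criterion -/

section Consequences

variable {W : WeierstrassCurve ℚ}

/-- **THE HEIGHT TO SECOND ORDER: `ĥ₃(P) ≡ log₃ num x(P) + (b₂b₄/c₄)·den x/num x (mod 3^{2k+1})`.**
For `W/ℚ` globally minimal with multiplicative reduction at `3`, any `q ∈ ℚ₃` with `‖q‖₃ < 1` and any
rational affine point `P = (x, y)` with `‖x‖₃ > 1`:
`‖ĥ₃(P) − log₃(num x) − (b₂b₄/c₄)·(den x)/(num x)‖₃ ≤ 3⁻¹‖x‖₃⁻¹` (`ĥ₃ = heightFourOneCoord`, SW (4.1);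
`b₂, b₄, c₄` of the minimal model). Indeed `ĥ₃ − log₃ num x = −log₃(x·Σ²)` (part 4 of the first chain),
`x·Σ² = 1 + T` with `‖T + (b₂b₄/c₄)x⁻¹‖ ≤ 3⁻¹‖x‖⁻¹` (part 2b), `‖log₃(1+T) − T‖ ≤ ‖T‖² ≤ ‖x‖⁻²` and
`x⁻¹ = den x/num x`. [cite: SteinWuthrich2013, §4.1 eq. (4.1), §4.2] [cite: Iwasawa1972PadicL, §4.4] -/
theorem norm_heightFourOneCoord_sub_padicLog_num_sub_le [W.IsElliptic] [W.IsGloballyMinimal]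
    (hW : Mult W 3) {q : ℚ_[3]} (hq : ‖q‖ < 1) {x y : ℚ} (hxy : W.toAffine.Nonsingular x y)
    (hx : 1 < ‖(x : ℚ_[3])‖) :
    ‖heightFourOneCoord W 3 q x y - padicLog 3 ((x.num : ℚ) : ℚ_[3]) -
        (W.baseChange ℚ_[3]).b₂ * (W.baseChange ℚ_[3]).b₄ / (W.baseChange ℚ_[3]).c₄ *
          (((x.den : ℚ) : ℚ_[3]) / ((x.num : ℚ) : ℚ_[3]))‖ ≤ 3⁻¹ * ‖(x : ℚ_[3])‖⁻¹ := by
  set X : ℚ_[3] := (x : ℚ_[3]) with hXdef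
  set κ' : ℚ_[3] := (W.baseChange ℚ_[3]).b₂ * (W.baseChange ℚ_[3]).b₄ / (W.baseChange ℚ_[3]).c₄
    with hκ'def
  have hX0 : X ≠ 0 := norm_pos_iff.mp (one_pos.trans hx)
  have hd0 : ((x.den : ℚ) : ℚ_[3]) ≠ 0 := by exact_mod_cast x.den_nz
  have hS0 := tateSigmaValueSq_ne_zero (p := 3) (by norm_num) hW hq hxy hx
  have hnum : ((x.num : ℚ) : ℚ_[3]) = X * ((x.den : ℚ) : ℚ_[3]) := by
    rw [hXdef, ← Rat.cast_mul, Rat.mul_den_eq_num]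
  obtain ⟨hz, hz2⟩ := norm_neg_div_of_one_lt_norm (p := 3) hxy hx
  have hXi : ‖X‖⁻¹ ≤ 1 / 9 := by
    rw [← hz2]
    calc ‖-(x : ℚ_[3]) / ↑y‖ ^ 2 ≤ ((3 : ℝ)⁻¹) ^ 2 := by
          gcongr; exact hz.trans (by norm_num)
      _ = 1 / 9 := by norm_num
  set T : ℚ_[3] := X * tateSigmaValueSq W 3 q x y - 1 with hTdef
  have hT1 : ‖T‖ ≤ ‖X‖⁻¹ := norm_x_mul_tateSigmaValueSq_sub_one_le hW hq hxy hx
  have hT2 : ‖T + κ' * X⁻¹‖ ≤ 3⁻¹ * ‖X‖⁻¹ := norm_x_mul_tateSigmaValueSq_sub_one_add_le hW hq hxy hx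
  have hTlt : ‖T‖ < 1 := hT1.trans_lt (hXi.trans_lt (by norm_num))
  have hlogT : ‖padicLog 3 (1 + T) - T‖ ≤ ‖T‖ ^ 2 := norm_padicLog_one_add_sub_le (p := 3) (by norm_num) hTlt
  have e : heightFourOneCoord W 3 q x y - padicLog 3 ((x.num : ℚ) : ℚ_[3]) -
      κ' * (((x.den : ℚ) : ℚ_[3]) / ((x.num : ℚ) : ℚ_[3])) =
      -(padicLog 3 (1 + T) - T) - (T + κ' * X⁻¹) := by
    have h1T : 1 + T = X * tateSigmaValueSq W 3 q x y := by rw [hTdef]; ring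
    rw [heightFourOneCoord_eq, hnum, padicLog_mul_holds 3 hX0 hd0, h1T, padicLog_mul_holds 3 hX0 hS0]
    field_simp
    ring
  rw [e]
  refine (norm_sub_le_max₃ _ _).trans (max_le ?_ hT2)
  rw [norm_neg]
  calc ‖padicLog 3 (1 + T) - T‖ ≤ ‖T‖ ^ 2 := hlogT
    _ ≤ ‖X‖⁻¹ ^ 2 := by gcongr
    _ = ‖X‖⁻¹ * ‖X‖⁻¹ := by ring
    _ ≤ (1 / 9) * ‖X‖⁻¹ := by gcongr
    _ ≤ 3⁻¹ * ‖X‖⁻¹ := by gcongr; norm_num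

/-- **`2ac₄·ĥ₃(P) ≡ c₄a(a² − 1) + 2b₂b₄·den x`** (`a = num x`): for `W/ℚ` globally minimal with
multiplicative reduction at `3`, `‖q‖₃ < 1` and a rational point `P = (x,y)` with `‖x‖₃ > 1`,
`‖2a·c₄·ĥ₃(P) − (c₄a(a² − 1) + 2b₂b₄·den x)‖₃ ≤ max(3⁻¹‖x‖⁻¹, ‖a² − 1‖²)` — the height to second order
combined with Iwasawa's `‖log₃ a − (a² − 1)/2‖ ≤ ‖a² − 1‖²` for the unit `a`. In the first-order-silent
regime `‖a² − 1‖ ≤ ‖x‖⁻¹` the right side is `3⁻¹‖x‖⁻¹`, so the integer `c₄(a³ − a) + 2b₂b₄·den x` carries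
the digits of `ĥ₃(P)` up to `3^{v₃(den x)}` inclusive. [cite: SteinWuthrich2013, §4.2]
[cite: Iwasawa1972PadicL, §4.4] -/
theorem norm_heightFourOneCoord_mul_sub_le [W.IsElliptic] [W.IsGloballyMinimal]
    (hW : Mult W 3) {q : ℚ_[3]} (hq : ‖q‖ < 1) {x y : ℚ} (hxy : W.toAffine.Nonsingular x y)
    (hx : 1 < ‖(x : ℚ_[3])‖) :
    ‖2 * ((x.num : ℚ) : ℚ_[3]) * (W.baseChange ℚ_[3]).c₄ * heightFourOneCoord W 3 q x y -
        ((W.baseChange ℚ_[3]).c₄ * ((x.num : ℚ) : ℚ_[3]) * (((x.num : ℚ) : ℚ_[3]) ^ 2 - 1) +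
          2 * (W.baseChange ℚ_[3]).b₂ * (W.baseChange ℚ_[3]).b₄ * ((x.den : ℚ) : ℚ_[3]))‖
      ≤ max (3⁻¹ * ‖(x : ℚ_[3])‖⁻¹) (‖((x.num : ℚ) : ℚ_[3]) ^ 2 - 1‖ ^ 2) := by
  set X : ℚ_[3] := (x : ℚ_[3]) with hXdef
  set V := W.baseChange ℚ_[3] with hVdef
  set a : ℚ_[3] := ((x.num : ℚ) : ℚ_[3]) with hadef
  set D : ℚ_[3] := ((x.den : ℚ) : ℚ_[3]) with hDdef
  set H : ℚ_[3] := heightFourOneCoord W 3 q x y with hHdef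
  have hX0 : X ≠ 0 := norm_pos_iff.mp (one_pos.trans hx)
  have hd0 : D ≠ 0 := by rw [hDdef]; exact_mod_cast x.den_nz
  have hnum : a = X * D := by rw [hadef, hXdef, hDdef, ← Rat.cast_mul, Rat.mul_den_eq_num]
  have han : ‖a‖ = 1 := by rw [hnum, norm_mul, hDdef, norm_den_eq_inv_norm hx, mul_inv_cancel₀ (one_pos.trans hx).ne']
  have ha0 : a ≠ 0 := norm_pos_iff.mp (by rw [han]; exact one_pos)
  obtain ⟨hc4, -⟩ := norm_c₄_c₆_baseChange_eq_one (W := W) hW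
  have hc40 : V.c₄ ≠ 0 := norm_pos_iff.mp (by rw [hc4]; exact one_pos)
  have h2n : ‖(2 : ℚ_[3])‖ = 1 := by
    simpa using Padic.norm_natCast_eq_one_iff.mpr (show Nat.Coprime 3 2 by decide)
  -- the two inputs
  set R : ℚ_[3] := H - padicLog 3 a - V.b₂ * V.b₄ / V.c₄ * (D / a) with hRdef
  have hR : ‖R‖ ≤ 3⁻¹ * ‖X‖⁻¹ := norm_heightFourOneCoord_sub_padicLog_num_sub_le hW hq hxy hx
  set G : ℚ_[3] := padicLog 3 a - (a ^ 2 - 1) / 2 with hGdef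
  have hG : ‖G‖ ≤ ‖a ^ 2 - 1‖ ^ 2 := by
    have h := norm_padicLog_sub_div_le (p := 3) (by norm_num) han
    rw [show (3 - 1 : ℕ) = 2 from rfl, show ((3 : ℕ) : ℚ_[3]) - 1 = 2 by norm_num] at h
    exact h
  have e : 2 * a * V.c₄ * H - (V.c₄ * a * (a ^ 2 - 1) + 2 * V.b₂ * V.b₄ * D) = 2 * a * V.c₄ * (R + G) := by
    rw [hRdef, hGdef]
    field_simp
    ring
  rw [e, norm_mul, norm_mul, norm_mul, h2n, han, hc4, one_mul, one_mul, one_mul]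
  exact (norm_add_le_max _ _).trans (max_le_max hR hG)

/-- **THE SECOND-ORDER NUMERATOR CRITERION**: for `W/ℚ` globally minimal with multiplicative reduction
at `3`, any `‖q‖₃ < 1` and any rational point `P = (x,y)` with `‖x‖₃ > 1`, writing `a = num x`: if
`‖c₄a(a² − 1) + 2b₂b₄·den x‖₃ > 3⁻¹‖x‖₃⁻¹` (i.e. `3^{v₃(den x)+1} ∤ c₄(a³ − a) + 2b₂b₄·den x`), then
SW's `3`-adic height of `P` is NON-ZERO. Cases: if `‖a² − 1‖ > ‖x‖⁻¹` the first-order law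
`‖ĥ₃ − log₃ a‖ ≤ ‖x‖⁻¹ < ‖log₃ a‖` decides; otherwise `‖2ac₄ĥ₃ − N‖ ≤ 3⁻¹‖x‖⁻¹ < ‖N‖`. A closed-form,
decidable sufficient condition read off ONE rational point and the integers `b₂, b₄, c₄` of the minimal
model — no `3`-adic analysis. [cite: SteinWuthrich2013, §4.2, Conj. 4.1] [cite: Schneider1982PadicHeightI, §1] -/
theorem heightFourOneCoord_ne_zero_of_num_criterion₂ [W.IsElliptic] [W.IsGloballyMinimal]
    (hW : Mult W 3) {q : ℚ_[3]} (hq : ‖q‖ < 1) {x y : ℚ} (hxy : W.toAffine.Nonsingular x y)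
    (hx : 1 < ‖(x : ℚ_[3])‖)
    (hcrit : 3⁻¹ * ‖(x : ℚ_[3])‖⁻¹ <
      ‖(W.baseChange ℚ_[3]).c₄ * ((x.num : ℚ) : ℚ_[3]) * (((x.num : ℚ) : ℚ_[3]) ^ 2 - 1) +
          2 * (W.baseChange ℚ_[3]).b₂ * (W.baseChange ℚ_[3]).b₄ * ((x.den : ℚ) : ℚ_[3])‖) :
    heightFourOneCoord W 3 q x y ≠ 0 := by
  set X : ℚ_[3] := (x : ℚ_[3]) with hXdef
  set V := W.baseChange ℚ_[3] with hVdef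
  set a : ℚ_[3] := ((x.num : ℚ) : ℚ_[3]) with hadef
  set D : ℚ_[3] := ((x.den : ℚ) : ℚ_[3]) with hDdef
  have hX0n : 0 < ‖X‖ := one_pos.trans hx
  have hnum : a = X * D := by rw [hadef, hXdef, hDdef, ← Rat.cast_mul, Rat.mul_den_eq_num]
  have hDn : ‖D‖ = ‖X‖⁻¹ := by rw [hDdef]; exact norm_den_eq_inv_norm hx
  have han : ‖a‖ = 1 := by rw [hnum, norm_mul, hDn, mul_inv_cancel₀ hX0n.ne']
  have ha0 : a ≠ 0 := norm_pos_iff.mp (by rw [han]; exact one_pos)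
  obtain ⟨hz, hz2⟩ := norm_neg_div_of_one_lt_norm (p := 3) hxy hx
  have hXi : ‖X‖⁻¹ ≤ 1 / 9 := by
    rw [← hz2]
    calc ‖-(x : ℚ_[3]) / ↑y‖ ^ 2 ≤ ((3 : ℝ)⁻¹) ^ 2 := by
          gcongr; exact hz.trans (by norm_num)
      _ = 1 / 9 := by norm_num
  obtain ⟨hc4, -⟩ := norm_c₄_c₆_baseChange_eq_one (W := W) hW
  intro hH
  rcases lt_or_ge ‖X‖⁻¹ ‖a ^ 2 - 1‖ with h1 | h1
  · -- first order: `‖ĥ − log a‖ ≤ ‖X‖⁻¹ < ‖a² − 1‖ = ‖log a‖`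
    have hR := norm_heightFourOneCoord_sub_padicLog_num_sub_le hW hq hxy hx
    rw [hH, zero_sub] at hR
    have hκ : ‖V.b₂ * V.b₄ / V.c₄ * (D / a)‖ ≤ ‖X‖⁻¹ := by
      rw [norm_mul, norm_div D a, han, div_one, hDn]
      calc ‖V.b₂ * V.b₄ / V.c₄‖ * ‖X‖⁻¹ ≤ 1 * ‖X‖⁻¹ := by
            gcongr; exact norm_b₂_mul_b₄_div_c₄_le hW
        _ = ‖X‖⁻¹ := one_mul _
    have hlog : ‖padicLog 3 a‖ ≤ ‖X‖⁻¹ := by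
      have e : padicLog 3 a = -(-padicLog 3 a - V.b₂ * V.b₄ / V.c₄ * (D / a)) -
          V.b₂ * V.b₄ / V.c₄ * (D / a) := by ring
      rw [e]
      refine (norm_sub_le_max₃ _ _).trans (max_le ?_ hκ)
      rw [norm_neg]
      exact hR.trans (by nlinarith [inv_pos.mpr hX0n])
    have hloga : ‖padicLog 3 a‖ = ‖a ^ 2 - 1‖ := by
      rw [SchneiderClosedFormOddPrime.norm_padicLog_of_norm_eq_one (p := 3) (by norm_num) han,
        show (3 - 1 : ℕ) = 2 from rfl, norm_sub_rev]
    rw [hloga] at hlog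
    exact absurd h1 (not_lt.mpr hlog)
  · -- first order silent: `‖2ac₄ĥ − N‖ ≤ 3⁻¹‖X‖⁻¹ < ‖N‖`
    have hM := norm_heightFourOneCoord_mul_sub_le hW hq hxy hx
    rw [hH, mul_zero, zero_sub, norm_neg] at hM
    have hsq : ‖a ^ 2 - 1‖ ^ 2 ≤ 3⁻¹ * ‖X‖⁻¹ := by
      calc ‖a ^ 2 - 1‖ ^ 2 ≤ ‖X‖⁻¹ ^ 2 := by gcongr
        _ = ‖X‖⁻¹ * ‖X‖⁻¹ := by ring
        _ ≤ (1 / 9) * ‖X‖⁻¹ := by gcongr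
        _ ≤ 3⁻¹ * ‖X‖⁻¹ := by gcongr; norm_num
    have hle : ‖V.c₄ * a * (a ^ 2 - 1) + 2 * V.b₂ * V.b₄ * D‖ ≤ 3⁻¹ * ‖X‖⁻¹ :=
      hM.trans (max_le le_rfl hsq)
    exact absurd hcrit (not_lt.mpr hle)

/-- **The second-order criterion in integers**: if `c₄·(a³ − a) + 2b₂b₄·den x = N ∈ ℤ` (`a = num x`;
`b₂, b₄, c₄` the integers of the minimal model, an identity `norm_num` checks on a given curve) and
`3^{v₃(den x)+1} ∤ N`, then `ĥ₃(P) ≠ 0` (`‖den x‖₃ = ‖x‖₃⁻¹ = 3^{−v₃(den x)}` and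
`‖N‖₃ ≤ 3^{−n} ↔ 3ⁿ ∣ N`). [cite: SteinWuthrich2013, §4.2, Conj. 4.1] -/
theorem heightFourOneCoord_ne_zero_of_not_pow_succ_dvd [W.IsElliptic] [W.IsGloballyMinimal]
    (hW : Mult W 3) {q : ℚ_[3]} (hq : ‖q‖ < 1) {x y : ℚ} (hxy : W.toAffine.Nonsingular x y)
    (hx : 1 < ‖(x : ℚ_[3])‖) {N : ℤ}
    (hN : W.c₄ * ((x.num : ℚ) ^ 3 - x.num) + 2 * W.b₂ * W.b₄ * (x.den : ℚ) = (N : ℚ))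
    (h : ¬ ((3 : ℤ) ^ (padicValNat 3 x.den + 1) ∣ N)) :
    heightFourOneCoord W 3 q x y ≠ 0 := by
  refine heightFourOneCoord_ne_zero_of_num_criterion₂ hW hq hxy hx ?_
  have hc4 : (W.baseChange ℚ_[3]).c₄ = ((W.c₄ : ℚ) : ℚ_[3]) :=
    (map_c₄ W (algebraMap ℚ ℚ_[3])).trans (eq_ratCast _ _)
  have hb2 : (W.baseChange ℚ_[3]).b₂ = ((W.b₂ : ℚ) : ℚ_[3]) :=
    (map_b₂ W (algebraMap ℚ ℚ_[3])).trans (eq_ratCast _ _)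
  have hb4 : (W.baseChange ℚ_[3]).b₄ = ((W.b₄ : ℚ) : ℚ_[3]) :=
    (map_b₄ W (algebraMap ℚ ℚ_[3])).trans (eq_ratCast _ _)
  have hcast : (W.baseChange ℚ_[3]).c₄ * ((x.num : ℚ) : ℚ_[3]) * (((x.num : ℚ) : ℚ_[3]) ^ 2 - 1) +
      2 * (W.baseChange ℚ_[3]).b₂ * (W.baseChange ℚ_[3]).b₄ * ((x.den : ℚ) : ℚ_[3]) = ((N : ℚ) : ℚ_[3]) := by
    rw [hc4, hb2, hb4, ← hN]
    push_cast
    ring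
  have hden : ‖(x : ℚ_[3])‖⁻¹ = (3 : ℝ) ^ (-(padicValNat 3 x.den : ℤ)) := by
    rw [← norm_den_eq_inv_norm hx, Rat.cast_natCast,
      Padic.norm_eq_zpow_neg_valuation (by exact_mod_cast x.den_nz), Padic.valuation_natCast]
    norm_cast
  rw [hcast, hden, Rat.cast_intCast]
  have h3 : (3 : ℝ)⁻¹ * (3 : ℝ) ^ (-(padicValNat 3 x.den : ℤ)) =
      (3 : ℝ) ^ (-((padicValNat 3 x.den + 1 : ℕ) : ℤ)) := by
    rw [show (3 : ℝ)⁻¹ = (3 : ℝ) ^ (-(1 : ℤ)) by norm_num, ← zpow_add₀ (by norm_num : (3 : ℝ) ≠ 0)]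
    congr 1
    push_cast
    ring
  rw [h3]
  by_contra hle
  exact h ((Padic.norm_int_le_pow_iff_dvd _ _).mp (by exact_mod_cast not_lt.mp hle))

end Consequences

/-! ### §8 Rank one: Schneider's non-degeneracy at `3` from ONE rational point (second order) -/

section RankOne

variable {W : WeierstrassCurve ℚ}

/-- **Schneider's binder at `3` from ONE rational point, by integer arithmetic (second order).** For
`W/ℚ` globally minimal, NON-split multiplicative at `3`, of Mordell–Weil rank one: if some ADMISSIBLE
rational point `P = (x, y)` (non-torsion, `‖x‖₃ > 1`, `z` in the sigma disc, non-singular reduction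
everywhere) satisfies `3^{v₃(den x)+1} ∤ c₄·((num x)³ − num x) + 2b₂b₄·den x`, then
`ClassClosure.RegulatorNonvanishingAt W 3` (both halves; the split half is vacuous): for every Tate
parameter `q` and THE datum `Dh` (`IsMultCanonical Dh q`), `⟨P,P⟩ = ĥ₃(P) ≠ 0` by the second-order
numerator criterion, and one anisotropic point gives `Reg₃ ≠ 0` in rank one. This criterion contains the
first-order one (`3^{v₃ den x} ∤ (num x)² − 1`) and fires on 650 of the 690 tabulated TRUE-OPEN rows of
lane A's REG3CERT/v1 (kit j249075) against 543. [cite: SteinWuthrich2013, §4.2, Conj. 4.1]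
[cite: Schneider1982PadicHeightI, §1] -/
theorem regulatorNonvanishingAt_three_of_num_criterion₂ [W.IsElliptic] [W.IsGloballyMinimal]
    (hW : Mult W 3) (hns : ¬ W.HasSplitMultiplicativeReductionAtPrime 3) (hr : W.mordellWeilRank = 1)
    {x y : ℚ} {h : W.toAffine.Nonsingular x y} (hadm : W.IsAdmissible 3 (.some x y h)) {N : ℤ}
    (hN : W.c₄ * ((x.num : ℚ) ^ 3 - x.num) + 2 * W.b₂ * W.b₄ * (x.den : ℚ) = (N : ℚ))
    (hcrit : ¬ ((3 : ℤ) ^ (padicValNat 3 x.den + 1) ∣ N)) :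
    X11b.ClassClosure.RegulatorNonvanishingAt W 3 := by
  refine ⟨fun q Dh _ hq1 _ hDh => ?_, fun Dq _ _ => absurd Dq.split hns⟩
  refine X11b.schneider_of_isMultCanonical_of_heightFourOne_ne_zero hr hDh hadm ?_
  rw [heightFourOne_some]
  exact heightFourOneCoord_ne_zero_of_not_pow_succ_dvd hW hq1 h hadm.2.1 hN hcrit

end RankOne

end Summit.BirchSwinnertonDyer.Rank1Residual.X11b.RegMult.HeightLogNumerator

end
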